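import Literature.Computability.Complexity.SymmetricThresholdProgramsVecCmp
import Summits.PneNP.PneNP.Theorems.SymmetryBudgetNoHiddenOrderDecodeDefs
import Summits.PneNP.PneNP.Theorems.SymmetryBudgetNoHiddenOrderBitValuationDefs

/-!
# `NoHiddenOrder` (stmt-PneNP-14781), (R2c) value layer V: the value of a label at an INDIVIDUALISATION node — definitions

Route `PneNP/SymmetryBudget`.  The gate-level realisation of the individualisation case of `CertifiedLabels.val` with the bit valuation
(`…BitValuationDefs`: `lift`, `pick`) for a label `L = (U, X, λ)` whose decoded instance is `(U, col)` (colours and bit width both `n`): the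
module `VOr` reads

* the final analysis of `L` (membership, one-hot colour values, order/kernel, the first smallest cell `sel`, adjacency), and
* for every CANDIDATE `κ = (x, v)` (`x ∈ U ∖ X`, value `v < n`) four families of EXTERNAL wires of the candidate label `L.cand x v`: `cdOK`
  (it decodes), `cdVal w c` (one-hot colours of its decoded instance), `cdOk` (it has a value), `cdBit b` (the bits of its value);

and computes: the colouring individualised at `x` and its refinement with value read-out (`RVc x`, a `RefVal`), the CERTIFICATION `eqc κ`
("the candidate decodes to the child at `x`": its colours are those of `refineIn G U (indiv col x)`, bit by bit), `kept κ` (the guard of `val`: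
static admissibility, `x` in the first smallest cell, certified, valued), the LIFTED value (colour bits `liftC` read back through the refined
classes, adjacency bits the candidate's own: `lw`), a `VecCmp` over candidates, `best κ` (kept and no kept candidate is lexicographically
smaller), and the OUTPUTS `orOk` (some candidate is kept) and `orBit b` (bit `b` of the least kept lifted value).  Semantics in `…ValueOr.lean`.
Definitions only; supports stmt-PneNP-14781.
-/

set_option linter.dupNamespace false -- `Summit.PneNP.PneNP.…` (D-0017 single-conjunct layout)

namespace Summit.PneNP.PneNP.Theorems

open Finset Literature.Computability.Complexity Literature.Computability.Complexity.SymProg CGBits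

variable {ι Λ : Type*} [DecidableEq ι] [DecidableEq Λ] (P : SymProg ι Λ)
variable (V : Type*) [Fintype V] [DecidableEq V] (N T n : ℕ) (U X : Finset V) (lam : V → ℕ)
  (adm : CertifiedLabels.Label V → Prop) [DecidablePred adm]

/-- The lifted value WIRE of bit `b` of candidate `κ`: a colour bit is the gate `liftC κ i c`, an adjacency bit is the candidate's own bit.
[folklore] -/
def liftWire {ι Λ V : Type*} {n : ℕ} (liftC : V × Fin n → Fin n → Fin n → Λ) (cdBit : V × Fin n → Fin (NB n) → ι ⊕ Λ)
    (κ : V × Fin n) (b : Fin (NB n)) : ι ⊕ Λ :=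
  match bdec b with
  | .inl (i, c) => Sum.inr (liftC κ i c)
  | .inr (i, j) => cdBit κ (aIdx i j)

/-- **The value module at an individualisation node** (see the module docstring). Candidates are `κ : V × Fin n`. [folklore] -/
structure VOr where
  /-- INPUT: block membership of the decoded instance (`= U` when decoded) -/
  mem : V → ι ⊕ Λ
  /-- INPUT: one-hot colours of the decoded instance -/
  val : V → Fin n → ι ⊕ Λ
  /-- INPUT: order of the colouring -/
  lt : V → V → ι ⊕ Λ
  /-- INPUT: kernel of the colouring -/
  eq : V → V → ι ⊕ Λ
  /-- INPUT: first-smallest-cell wires -/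
  sel : V → ι ⊕ Λ
  /-- INPUT: adjacency -/
  adj : V → V → ι ⊕ Λ
  /-- EXTERNAL: the candidate label decodes -/
  cdOK : V × Fin n → ι ⊕ Λ
  /-- EXTERNAL: one-hot colours of the candidate's decoded instance -/
  cdVal : V × Fin n → V → Fin n → ι ⊕ Λ
  /-- EXTERNAL: the candidate label has a value -/
  cdOk : V × Fin n → ι ⊕ Λ
  /-- EXTERNAL: the bits of the candidate's value -/
  cdBit : V × Fin n → Fin (NB n) → ι ⊕ Λ
  /-- the constant false -/
  ff : Λ
  /-- `ltx x u v`: order of `indiv col x` -/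
  ltx : V → V → V → Λ
  /-- `eqx x u v`: kernel of `indiv col x` -/
  eqx : V → V → V → Λ
  /-- refinement of `indiv col x` inside the block with value read-out -/
  RVc : V → RefVal P V N T n
  /-- `bothc κ w c = cdVal κ w c ∧ (RVc x).val w c` -/
  bothc : V × Fin n → V → Fin n → Λ
  /-- `nonec κ w c = ¬cdVal κ w c ∧ ¬(RVc x).val w c` -/
  nonec : V × Fin n → V → Fin n → Λ
  /-- `xnc κ w c = (cdVal κ w c ↔ (RVc x).val w c)` -/
  xnc : V × Fin n → V → Fin n → Λ
  /-- `eqc κ`: certified — decodes, with the colours of the child at `x` -/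
  eqc : V × Fin n → Λ
  /-- `kept κ`: the candidate contributes to the choice -/
  kept : V × Fin n → Λ
  /-- `cmu x c' c u = mem u ∧ (RVc x).val u c' ∧ val u c` -/
  cmu : V → Fin n → Fin n → V → Λ
  /-- `cm x c' c`: the child class `c'` lies in the `col`-class `c` -/
  cm : V → Fin n → Fin n → Λ
  /-- `lc κ i c' c = cdBit κ (cIdx i c') ∧ cm x c' c` -/
  lc : V × Fin n → Fin n → Fin n → Fin n → Λ
  /-- `liftC κ i c`: colour bit `(i, c)` of the lifted value -/
  liftC : V × Fin n → Fin n → Fin n → Λ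
  /-- comparison of lifted value vectors -/
  VC : P.VecCmp (V × Fin n) (NB n)
  /-- `beat κ' κ = kept κ' ∧ less κ' κ` -/
  beat : V × Fin n → V × Fin n → Λ
  /-- `nbeat κ' κ` -/
  nbeat : V × Fin n → V × Fin n → Λ
  /-- `best κ`: kept and not beaten -/
  best : V × Fin n → Λ
  /-- OUTPUT `orOk`: some candidate is kept -/
  orOk : Λ
  /-- `ob κ b = best κ ∧ lw κ b` -/
  ob : V × Fin n → Fin (NB n) → Λ
  /-- OUTPUT `orBit b`: bit `b` of the chosen value -/
  orBit : Fin (NB n) → Λ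
  kind_ff : P.kind ff = Kind.or
  srcs_ff : P.srcs ff = ∅
  kind_ltx : ∀ x u v, P.kind (ltx x u v) = Kind.or
  srcs_ltx : ∀ x u v, P.srcs (ltx x u v) = if v = x ∧ u ≠ x then {lt u v, eq u v} else {lt u v}
  kind_eqx : ∀ x u v, P.kind (eqx x u v) = Kind.and
  srcs_eqx : ∀ x u v, P.srcs (eqx x u v) = if (u = x ↔ v = x) then {eq u v} else {Sum.inr ff}
  RVc_mem : ∀ x, (RVc x).RI.mem = mem
  RVc_adj : ∀ x, (RVc x).RI.adj = adj
  RVc_lt0 : ∀ x u v, (RVc x).RI.lt0 u v = Sum.inr (ltx x u v)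
  RVc_eq0 : ∀ x u v, (RVc x).RI.eq0 u v = Sum.inr (eqx x u v)
  kind_bothc : ∀ κ w c, P.kind (bothc κ w c) = Kind.and
  srcs_bothc : ∀ κ w c, P.srcs (bothc κ w c) = {cdVal κ w c, Sum.inr ((RVc κ.1).val w c)}
  kind_nonec : ∀ κ w c, P.kind (nonec κ w c) = Kind.nor
  srcs_nonec : ∀ κ w c, P.srcs (nonec κ w c) = {cdVal κ w c, Sum.inr ((RVc κ.1).val w c)}
  kind_xnc : ∀ κ w c, P.kind (xnc κ w c) = Kind.or
  srcs_xnc : ∀ κ w c, P.srcs (xnc κ w c) = {Sum.inr (bothc κ w c), Sum.inr (nonec κ w c)}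
  kind_eqc : ∀ κ, P.kind (eqc κ) = Kind.and
  srcs_eqc : ∀ κ, P.srcs (eqc κ) = insert (cdOK κ) ((univ : Finset (V × Fin n)).image fun wc => Sum.inr (xnc κ wc.1 wc.2))
  kind_kept : ∀ κ, P.kind (kept κ) =
    if κ.1 ∈ U ∧ κ.1 ∉ X ∧ adm ((⟨U, X, lam⟩ : CertifiedLabels.Label V).cand κ.1 κ.2) then Kind.and else Kind.or
  srcs_kept : ∀ κ, P.srcs (kept κ) =
    if κ.1 ∈ U ∧ κ.1 ∉ X ∧ adm ((⟨U, X, lam⟩ : CertifiedLabels.Label V).cand κ.1 κ.2) then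
      {sel κ.1, Sum.inr (eqc κ), cdOk κ} else ∅
  kind_cmu : ∀ x c' c u, P.kind (cmu x c' c u) = Kind.and
  srcs_cmu : ∀ x c' c u, P.srcs (cmu x c' c u) = {mem u, Sum.inr ((RVc x).val u c'), val u c}
  kind_cm : ∀ x c' c, P.kind (cm x c' c) = Kind.or
  srcs_cm : ∀ x c' c, P.srcs (cm x c' c) = univ.image fun u => Sum.inr (cmu x c' c u)
  kind_lc : ∀ κ i c' c, P.kind (lc κ i c' c) = Kind.and
  srcs_lc : ∀ κ i c' c, P.srcs (lc κ i c' c) = {cdBit κ (cIdx i c'), Sum.inr (cm κ.1 c' c)}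
  kind_liftC : ∀ κ i c, P.kind (liftC κ i c) = Kind.or
  srcs_liftC : ∀ κ i c, P.srcs (liftC κ i c) = univ.image fun c' => Sum.inr (lc κ i c' c)
  VC_b : ∀ κ b, VC.b κ b = liftWire liftC cdBit κ b
  kind_beat : ∀ κ' κ, P.kind (beat κ' κ) = Kind.and
  srcs_beat : ∀ κ' κ, P.srcs (beat κ' κ) = {Sum.inr (kept κ'), Sum.inr (VC.less κ' κ)}
  kind_nbeat : ∀ κ' κ, P.kind (nbeat κ' κ) = Kind.nor
  srcs_nbeat : ∀ κ' κ, P.srcs (nbeat κ' κ) = {Sum.inr (beat κ' κ)}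
  kind_best : ∀ κ, P.kind (best κ) = Kind.and
  srcs_best : ∀ κ, P.srcs (best κ) = insert (Sum.inr (kept κ)) (univ.image fun κ' => Sum.inr (nbeat κ' κ))
  kind_orOk : P.kind orOk = Kind.or
  srcs_orOk : P.srcs orOk = univ.image fun κ => Sum.inr (kept κ)
  kind_ob : ∀ κ b, P.kind (ob κ b) = Kind.and
  srcs_ob : ∀ κ b, P.srcs (ob κ b) = {Sum.inr (best κ), liftWire liftC cdBit κ b}
  kind_orBit : ∀ b, P.kind (orBit b) = Kind.or
  srcs_orBit : ∀ b, P.srcs (orBit b) = univ.image fun κ => Sum.inr (ob κ b)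

namespace VOr

variable {P V N T n U X lam adm}
variable (O : VOr P V N T n U X lam adm)

/-- The lifted value wire of bit `b` of candidate `κ`. [folklore] -/
abbrev lw (κ : V × Fin n) (b : Fin (NB n)) : ι ⊕ Λ := liftWire O.liftC O.cdBit κ b

/-- The label valued. [folklore] -/
abbrev lab (_O : VOr P V N T n U X lam adm) : CertifiedLabels.Label V := ⟨U, X, lam⟩

end VOr

end Summit.PneNP.PneNP.Theorems
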